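import Summits.QuantumFields.GaugeBoot.TiltedBoxLimitInvariance
import Summits.QuantumFields.GaugeBoot.TiltedLatticeAxisSwap
import HarnessLib

/-!
# Infinite-volume limit points of the 45°-tilted boxes, part 12: permutations of the transverse axes

HONEST FRAMING (cell `pub-gaugeboot`, page 1 of every file): the venture produces certified bounds
on lattice expectations at stated coupling, gauge group, dimension and torus size; NOT a mass gap,
NOT a continuum limit, NOT a string tension; NOT Yang–Mills-summit-bearing (barriers
`FixedCouplingUltralocality`, `PerturbativeInvisibility`). A structural symmetry fact about a class
of infinite-volume Wilson states; nothing else is claimed.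

## Content

`TiltedBoxLimitInvariance.lean` gives invariance of every tilted limit point
`μ ∈ tiltedBoxLimitPoints d i j ρ β` under the transposition `(i j)` of the two tilted axes and under
all coordinate reflections. Here the transpositions `(k l)` of two TRANSVERSE axes `k, l ∉ {i, j}`
(both of period `2(Q + 2)` in every box of the family, so `Γ` is invariant and the box measure too,
`tiltedBox_integral_comp_axisSwap`, `TiltedLatticeAxisSwap.lean`):

* `tiltedLift_configSwap_transverse` — the lift intertwines the box axis swap `tiltedAxisSwap` with
  `configDiagSwapZd k l = configPerm (k l)` of `ClassB.lean`;
* **`measurePreserving_configPerm_swap_transverse_of_mem_tiltedBoxLimitPoints`** — `μ` is invariant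
  under `configPerm (Equiv.swap k l)` for all `k, l ∉ {i, j}` (and trivially for `k = l`).

Together with `(i j)` these transpositions generate the stabiliser of the pair `{i, j}` in the
symmetric group of the axes — the axis-permutation symmetry a tilted-box SDP may quotient by (the
`permInvariant` field of `ClassBState` restricted to that stabiliser; the generation statement itself
is not spelled out here).

References: J. Fröhlich, R. Israel, E. H. Lieb, B. Simon, J. Stat. Phys. 22 (1980) 297, §3.
-/

noncomputable section

open MeasureTheory Filter Topology
open Literature.Probability.LatticeModels (Site)
open Literature.MathematicalPhysics.QuantumLattice

namespace Summit.QuantumFields.GaugeBoot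

namespace TiltedRP

variable {d : ℕ} {i j k l : Fin d} {N : ℕ}

/-- **Transverse axis swaps**: the lift carries the box swap of the axes `k, l ∉ {i, j}` to
`configDiagSwapZd k l` (the axis transposition `(k l)` of `ℤ^d` configurations). -/
theorem tiltedLift_configSwap_transverse {Mu Mv L : ℕ} {G : Type*} (hki : k ≠ i) (hkj : k ≠ j)
    (hli : l ≠ i) (hlj : l ≠ j) (U : Config (TiltedSite d i j Mu Mv L) d G) :
    tiltedLift d i j Mu Mv L (configSwap k l (tiltedAxisSwap d Mu Mv L hki hkj hli hlj) U) =
      configDiagSwapZd k l (tiltedLift d i j Mu Mv L U) := by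
  funext e
  simp only [tiltedLift_apply, configSwap, configDiagSwapZd, linkSwap_mk, tiltedAxisSwap_mk,
    swapHom_eq_zdDiagSwap]

variable {G : Type*} [Group G] [TopologicalSpace G] [IsTopologicalGroup G] [CompactSpace G]
  [MeasurableSpace G] [BorelSpace G] [SecondCountableTopology G]
variable (ρ : G →* Matrix (Fin N) (Fin N) ℂ)

/-- **Box step**: `∫ F(configDiagSwapZd k l (tiltedLift U)) dμ_β = ∫ F(tiltedLift U) dμ_β` for
`k, l ∉ {i, j}` on every box. -/
theorem integral_comp_configDiagSwapZd_transverse_tiltedLift {Mu Mv L : ℕ} [NeZero Mu] [NeZero Mv]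
    [NeZero L] (hki : k ≠ i) (hkj : k ≠ j) (hli : l ≠ i) (hlj : l ≠ j) (hρ : Continuous ρ) (β : ℝ)
    {F : LGConfig d G → ℝ} (hFm : Measurable F) :
    ∫ U, F (configDiagSwapZd k l (tiltedLift d i j Mu Mv L U)) ∂(gibbs ρ (tiltedUnit d i j Mu Mv L) β) =
      ∫ U, F (tiltedLift d i j Mu Mv L U) ∂(gibbs ρ (tiltedUnit d i j Mu Mv L) β) := by
  simp_rw [← tiltedLift_configSwap_transverse hki hkj hli hlj]
  exact tiltedBox_integral_comp_axisSwap ρ hki hkj hli hlj hρ β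
    (hFm.comp (measurable_tiltedLift d i j Mu Mv L))

variable [T2Space G]

/-- **Every tilted limit point is invariant under the transposition of two transverse axes**
`k, l ∉ {i, j}`. -/
theorem map_configDiagSwapZd_transverse_eq_of_mem_tiltedBoxLimitPoints (hki : k ≠ i) (hkj : k ≠ j)
    (hli : l ≠ i) (hlj : l ≠ j) (hρ : Continuous ρ) {β : ℝ} {μ : Measure (LGConfig d G)}
    (hμ : μ ∈ tiltedBoxLimitPoints d i j ρ β) :
    μ.map (configDiagSwapZd k l) = μ := by
  obtain ⟨M, Q, -, -, h⟩ := hμ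
  exact h.map_eq_of_eventually DiagRP.measurable_configDiagSwapZd (continuous_configDiagSwapZd k l)
    (fun F S hFS => ⟨_, isCylinder_comp_configDiagSwapZd hFS k l⟩)
    fun F S _ hFc _ => Eventually.of_forall fun n =>
      integral_comp_configDiagSwapZd_transverse_tiltedLift ρ hki hkj hli hlj hρ β hFc.measurable

/-- **Axis-permutation invariance for the transpositions of transverse axes**: for `k, l ∉ {i, j}`,
`configPerm (Equiv.swap k l)` preserves every tilted limit point. With
`measurePreserving_configPerm_swap_of_mem_tiltedBoxLimitPoints` (the transposition `(i j)`) these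
generate the stabiliser of `{i, j}` among the axis permutations. -/
theorem measurePreserving_configPerm_swap_transverse_of_mem_tiltedBoxLimitPoints (hki : k ≠ i)
    (hkj : k ≠ j) (hli : l ≠ i) (hlj : l ≠ j) (hρ : Continuous ρ) {β : ℝ}
    {μ : Measure (LGConfig d G)} (hμ : μ ∈ tiltedBoxLimitPoints d i j ρ β) :
    MeasurePreserving (configPerm (G := G) (Equiv.swap k l)) μ μ := by
  rw [← configDiagSwapZd_eq_configPerm_swap]
  exact ⟨DiagRP.measurable_configDiagSwapZd,
    map_configDiagSwapZd_transverse_eq_of_mem_tiltedBoxLimitPoints ρ hki hkj hli hlj hρ hμ⟩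

end TiltedRP

end Summit.QuantumFields.GaugeBoot
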